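import Literature.AlgebraicGeometry.Motives.HodgeStructurePeriodDomainOpen
import Literature.AlgebraicGeometry.Motives.GeometricVHSPolarizedTransport
import HarnessLib

/-!
# Transport of the Weil operator, the Hodge components and the Hodge norm of a polarized Hodge structure along a
# linear equivalence (`HodgeStructure.comapEquiv`, `Polarization.comapEquiv`); chart-invariance of «`v` is close to `F^p`»

Topic `Literature/AlgebraicGeometry/Motives` (namespace `Literature.AlgebraicGeometry.Motives.HodgeStructure`), a leaf on
`Motives/HodgeStructurePeriodDomainOpen.lean` (the Hodge norm `‖x‖_P = √(Q_ℂ(Cx, x̄))` of a polarization `P` of a pure Hodge structure: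
`Polarization.hodgeNorm`, the graded scalar operators `pieceSMul`, the truncations `truncGE` / `truncLT`) and
`Motives/GeometricVHSPolarizedTransport.lean` (transport of structure along a `ℚ`-linear equivalence `e : V ≃ W`:
`HodgeStructure.comapEquiv H e` = the Hodge structure `e_ℂ⁻¹ F^•` on `V`, `Polarization.comapEquiv Q e` = `Q(e x, e y)`,
`Polarization.copy`, `Polarization.mapEquiv`).  THEOREMS ONLY (no definition, no named fact, no instance; D-0026 net debt `0`).

THE (MISSING) API.  The Hodge METRIC of a polarized Hodge structure is functorial under isomorphisms: for `e : V ≃ₗ[ℚ] W`,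
`H` a Hodge structure of weight `n` on `W` with polarization `Q`,
* §1 `e_ℂ` intertwines the graded scalar operators, the Weil operators `C`, their inverses, the Hodge components `x ↦ x^{p,n−p}` and
  the truncations `π_{≥p}`, `π_{<p}` of `H.comapEquiv e` and `H` (`comapEquiv_pieceSMul`, `comapEquiv_weilOperator`,
  `comapEquiv_weilOperator_symm`, `comapEquiv_pieceProj`, `comapEquiv_truncGE`, `comapEquiv_truncLT`) — `e` IS a morphism of Hodge
  structures `H.comapEquiv e → H` and morphisms respect the bigrading (the tree's `Hom.baseChange_pieceSMul`);
* §2 **`‖x‖_{Q.comapEquiv e} = ‖e_ℂ x‖_Q`** (`Polarization.hodgeNorm_comapEquiv`; Carlson–Müller-Stach–Peters (2.6): the Hodge form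
  `h_C(φ, ψ) = b(Cφ, ψ̄)` is built from `b` and `C`, both transported), the inner product likewise
  (`Polarization.form_baseChange_weilOperator_conj_comapEquiv`), and the variants for `e⁻¹` (`hodgeNorm_comapEquiv_symm_baseChange`),
  for `Polarization.copy` (`hodgeNorm_copy`) and for the push-forward `Polarization.mapEquiv` (`hodgeNorm_mapEquiv`);
* §3 the Hodge filtration of `H.comapEquiv e⁻¹` (a Hodge structure on `W` from one on `V`) is the IMAGE flag `e_ℂ F^•`
  (`comapEquiv_symm_F_eq_map`), and `Polarization.comapEquiv Q e⁻¹` has form `Q(e⁻¹ x, e⁻¹ y)`;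
* §4 **chart-invariance of the approximate-membership predicate of Cattani–Deligne–Kaplan 2.15** «`v ∼_Y F` if `v + w ∈ F` with
  `|w| ≤ exp(−αY)|v|`»: `(∃ f ∈ (H.comapEquiv e).F^p, ‖x − f‖ ≤ ε‖x‖) ⟺ (∃ f ∈ F^p, ‖e_ℂ x − f‖ ≤ ε‖e_ℂ x‖)`
  (`Polarization.exists_mem_F_hodgeNorm_sub_le_comapEquiv_iff`), with absolute bound (`…_le_const_…`), and through `e⁻¹`.
These are the identifications used to read CDK Theorem 2.16 (stated in the tree for a period map on a fixed space `V`) in the Hodge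
metric of the fibres `V_s` of a variation (`HodgeTheory/VHSDataApproximateHodgeClassesNearPuncture.lean`).

PRINTED SOURCES.  J. Carlson, S. Müller-Stach, C. Peters, *Period Mappings and Period Domains* (2nd ed., 2017), §2.3, eq. (2.6) and
Thm. 2.3.3: «`C|H^{p,q} =` multiplication by `i^{p−q}` … the hermitian form `h_C(φ, ψ) := b(Cφ, ψ̄)` is positive definite»;
P. Deligne, *Théorie de Hodge II*, 2.1.15 (morphisms of Hodge structures are strictly compatible with the bigrading);
E. Cattani, P. Deligne, A. Kaplan, *On the locus of Hodge classes*, J. AMS 8 (1995), 2.15 (p. 491) (the relation `v ∼_Y F`) and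
2.17 (ii) (p. 492) («In (2.16.1), we use the Hodge metric at `Φ(z)`»).  All statements here are routine transports of structure
([folklore]); the cites locate the transported notions.

## References

* [CarlsonMullerStachPeters2017] J. Carlson, S. Müller-Stach, C. Peters, *Period Mappings and Period Domains*, 2nd ed., CUP 2017,
  §2.3 eq. (2.6), Thm. 2.3.3.
* [DeligneHodgeII1971] P. Deligne, *Théorie de Hodge II*, Publ. Math. IHÉS 40 (1971), 1.2.5, 2.1.15.
* [CattaniDeligneKaplan1995] E. Cattani, P. Deligne, A. Kaplan, *On the locus of Hodge classes*, J. Amer. Math. Soc. 8 (1995)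
  483–506: 2.15 (p. 491), 2.17 (ii) (p. 492).
-/

noncomputable section

open scoped TensorProduct ComplexOrder

namespace Literature.AlgebraicGeometry.Motives.HodgeStructure

universe u v

variable {V : Type u} [AddCommGroup V] [Module ℚ V]
variable {W : Type v} [AddCommGroup W] [Module ℚ W]
variable {n : ℤ}

/-! ## §1 `e_ℂ` intertwines the graded operators of `H.comapEquiv e` and `H` -/

/-- **`e_ℂ ∘ c(H.comapEquiv e) = c(H) ∘ e_ℂ` for every graded scalar operator `c`**: the linear equivalence `e` is a morphism of Hodge
structures `H.comapEquiv e → H` (`e_ℂ(e_ℂ⁻¹F^p) ⊆ F^p`), and morphisms respect the bigrading. [cite: DeligneHodgeII1971, 2.1.15] -/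
theorem comapEquiv_pieceSMul (H : HodgeStructure W n) (e : V ≃ₗ[ℚ] W) (c : ℤ → ℂ) (x : ℂ ⊗[ℚ] V) :
    e.toLinearMap.baseChange ℂ ((H.comapEquiv e).pieceSMul c x) = H.pieceSMul c (e.toLinearMap.baseChange ℂ x) :=
  Hom.baseChange_pieceSMul (H₁ := H.comapEquiv e) (H₂ := H) ⟨e.toLinearMap, fun _ => Submodule.map_comap_le _ _⟩ c x

/-- **The Weil operators correspond under `e_ℂ`: `e_ℂ(C′x) = C(e_ℂ x)`** for `C′` the Weil operator of `H.comapEquiv e` and `C` that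
of `H` («`C|H^{p,q} =` multiplication by `i^{p−q}`», and `e_ℂ` carries `V^{p,q}` onto `W^{p,q}`).
[cite: CarlsonMullerStachPeters2017, §2.3 eq. (2.6)] [cite: DeligneHodgeII1971, 2.1.15] -/
theorem comapEquiv_weilOperator (H : HodgeStructure W n) (e : V ≃ₗ[ℚ] W) (x : ℂ ⊗[ℚ] V) :
    e.toLinearMap.baseChange ℂ ((H.comapEquiv e).weilOperator x) = H.weilOperator (e.toLinearMap.baseChange ℂ x) :=
  Hom.baseChange_weilOperator (H₁ := H.comapEquiv e) (H₂ := H) ⟨e.toLinearMap, fun _ => Submodule.map_comap_le _ _⟩ x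

/-- The inverse Weil operators correspond under `e_ℂ`: `e_ℂ(C′⁻¹x) = C⁻¹(e_ℂ x)`. [cite: CarlsonMullerStachPeters2017, §2.3 eq. (2.6)] -/
theorem comapEquiv_weilOperator_symm (H : HodgeStructure W n) (e : V ≃ₗ[ℚ] W) (x : ℂ ⊗[ℚ] V) :
    e.toLinearMap.baseChange ℂ ((H.comapEquiv e).weilOperator.symm x) = H.weilOperator.symm (e.toLinearMap.baseChange ℂ x) := by
  apply H.weilOperator.injective
  rw [LinearEquiv.apply_symm_apply, ← comapEquiv_weilOperator, LinearEquiv.apply_symm_apply]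

/-- The Hodge components correspond under `e_ℂ`: `e_ℂ(x^{p,n−p}) = (e_ℂ x)^{p,n−p}`. [cite: DeligneHodgeII1971, 1.2.5, 2.1.15] -/
theorem comapEquiv_pieceProj (H : HodgeStructure W n) (e : V ≃ₗ[ℚ] W) (p : ℤ) (x : ℂ ⊗[ℚ] V) :
    e.toLinearMap.baseChange ℂ ((H.comapEquiv e).pieceProj p x) = H.pieceProj p (e.toLinearMap.baseChange ℂ x) :=
  comapEquiv_pieceSMul H e _ x

/-- The truncations `π_{≥p}` correspond under `e_ℂ`. [cite: DeligneHodgeII1971, 1.2.5, 2.1.15] -/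
theorem comapEquiv_truncGE (H : HodgeStructure W n) (e : V ≃ₗ[ℚ] W) (p : ℤ) (x : ℂ ⊗[ℚ] V) :
    e.toLinearMap.baseChange ℂ ((H.comapEquiv e).truncGE p x) = H.truncGE p (e.toLinearMap.baseChange ℂ x) :=
  comapEquiv_pieceSMul H e _ x

/-- The truncations `π_{<p}` correspond under `e_ℂ`. [cite: DeligneHodgeII1971, 1.2.5, 2.1.15] -/
theorem comapEquiv_truncLT (H : HodgeStructure W n) (e : V ≃ₗ[ℚ] W) (p : ℤ) (x : ℂ ⊗[ℚ] V) :
    e.toLinearMap.baseChange ℂ ((H.comapEquiv e).truncLT p x) = H.truncLT p (e.toLinearMap.baseChange ℂ x) :=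
  comapEquiv_pieceSMul H e _ x

/-! ## §2 The Hodge norm is transported: `‖x‖_{Q.comapEquiv e} = ‖e_ℂ x‖_Q` -/

namespace Polarization

/-- The complexified transported form: `(Q.comapEquiv e)_ℂ(x, y) = Q_ℂ(e_ℂ x, e_ℂ y)`. [cite: CarlsonMullerStachPeters2017, §2.3 eq. (2.6)] -/
theorem comapEquiv_form_baseChange {H : HodgeStructure W n} (Q : Polarization H) (e : V ≃ₗ[ℚ] W) (x y : ℂ ⊗[ℚ] V) :
    (Q.comapEquiv e).form.baseChange ℂ x y = Q.form.baseChange ℂ (e.toLinearMap.baseChange ℂ x) (e.toLinearMap.baseChange ℂ y) :=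
  baseChange_compl₁₂ Q.form e.toLinearMap x y

/-- **The Hodge form is transported**: `(Q.comapEquiv e)_ℂ(C′x, ȳ) = Q_ℂ(C(e_ℂ x), conj(e_ℂ y))` (`h_C(φ, ψ) = b(Cφ, ψ̄)` read through
`e_ℂ`, which commutes with `C` and with complex conjugation). [cite: CarlsonMullerStachPeters2017, §2.3 eq. (2.6) and Thm. 2.3.3] -/
theorem form_baseChange_weilOperator_conj_comapEquiv {H : HodgeStructure W n} (Q : Polarization H) (e : V ≃ₗ[ℚ] W)
    (x y : ℂ ⊗[ℚ] V) :
    (Q.comapEquiv e).form.baseChange ℂ ((H.comapEquiv e).weilOperator x) (conj y) =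
      Q.form.baseChange ℂ (H.weilOperator (e.toLinearMap.baseChange ℂ x)) (conj (e.toLinearMap.baseChange ℂ y)) := by
  rw [comapEquiv_form_baseChange, comapEquiv_weilOperator, conj_baseChange]

/-- **THE HODGE NORM IS TRANSPORTED ALONG A LINEAR EQUIVALENCE: `‖x‖_{Q.comapEquiv e} = ‖e_ℂ x‖_Q`** — the Hodge metric of the
transported polarized Hodge structure `(H.comapEquiv e, Q.comapEquiv e)` on `V` is the Hodge metric of `(H, Q)` on `W` read through
`e_ℂ : V_ℂ ≃ W_ℂ`. [cite: CarlsonMullerStachPeters2017, §2.3 eq. (2.6) and Thm. 2.3.3] -/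
theorem hodgeNorm_comapEquiv {H : HodgeStructure W n} (Q : Polarization H) (e : V ≃ₗ[ℚ] W) (x : ℂ ⊗[ℚ] V) :
    (Q.comapEquiv e).hodgeNorm x = Q.hodgeNorm (e.toLinearMap.baseChange ℂ x) := by
  unfold hodgeNorm
  rw [form_baseChange_weilOperator_conj_comapEquiv]

/-- `‖x − y‖_{Q.comapEquiv e} = ‖e_ℂ x − e_ℂ y‖_Q`. [cite: CarlsonMullerStachPeters2017, §2.3 Thm. 2.3.3] -/
theorem hodgeNorm_comapEquiv_sub {H : HodgeStructure W n} (Q : Polarization H) (e : V ≃ₗ[ℚ] W) (x y : ℂ ⊗[ℚ] V) :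
    (Q.comapEquiv e).hodgeNorm (x - y) = Q.hodgeNorm (e.toLinearMap.baseChange ℂ x - e.toLinearMap.baseChange ℂ y) := by
  rw [hodgeNorm_comapEquiv, map_sub]

/-- Through the inverse: `‖e⁻¹_ℂ y‖_{Q.comapEquiv e} = ‖y‖_Q`. [cite: CarlsonMullerStachPeters2017, §2.3 Thm. 2.3.3] -/
theorem hodgeNorm_comapEquiv_symm_baseChange {H : HodgeStructure W n} (Q : Polarization H) (e : V ≃ₗ[ℚ] W) (y : ℂ ⊗[ℚ] W) :
    (Q.comapEquiv e).hodgeNorm (e.symm.toLinearMap.baseChange ℂ y) = Q.hodgeNorm y := by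
  rw [hodgeNorm_comapEquiv, baseChange_apply_symm_baseChange]

/-- For a Hodge structure `H` on `V` transported to `W` along `e⁻¹`: `‖e_ℂ x‖_{Q.comapEquiv e⁻¹} = ‖x‖_Q`.
[cite: CarlsonMullerStachPeters2017, §2.3 Thm. 2.3.3] -/
theorem hodgeNorm_comapEquiv_symm_apply_baseChange {H : HodgeStructure V n} (Q : Polarization H) (e : V ≃ₗ[ℚ] W) (x : ℂ ⊗[ℚ] V) :
    (Q.comapEquiv e.symm).hodgeNorm (e.toLinearMap.baseChange ℂ x) = Q.hodgeNorm x := by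
  rw [hodgeNorm_comapEquiv, symm_baseChange_apply_baseChange]

/-- On rational vectors: `‖1 ⊗ v‖_{Q.comapEquiv e} = ‖1 ⊗ e v‖_Q`. [cite: CarlsonMullerStachPeters2017, §2.3 Thm. 2.3.3] -/
theorem hodgeNorm_comapEquiv_ofRat {H : HodgeStructure W n} (Q : Polarization H) (e : V ≃ₗ[ℚ] W) (v : V) :
    (Q.comapEquiv e).hodgeNorm (ofRat v) = Q.hodgeNorm (ofRat (e v)) := by
  rw [hodgeNorm_comapEquiv, baseChange_ofRat, LinearEquiv.coe_coe]

/-- The Hodge norm of a polarization copied along an equality of Hodge structures is unchanged. [cite: CarlsonMullerStachPeters2017, §2.3 Thm. 2.3.3] -/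
theorem hodgeNorm_copy {H₁ H₂ : HodgeStructure V n} (Q : Polarization H₁) (h : H₁ = H₂) (x : ℂ ⊗[ℚ] V) :
    (Q.copy h).hodgeNorm x = Q.hodgeNorm x := by
  subst h
  rfl

/-- **The Hodge norm of the pushed-forward polarization**: for a polarization `Q` of `H.comapEquiv e`,
`‖y‖_{Q.mapEquiv e} = ‖e⁻¹_ℂ y‖_Q`. [cite: CarlsonMullerStachPeters2017, §2.3 Thm. 2.3.3] -/
theorem hodgeNorm_mapEquiv {H : HodgeStructure W n} (e : V ≃ₗ[ℚ] W) (Q : Polarization (H.comapEquiv e)) (y : ℂ ⊗[ℚ] W) :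
    (Q.mapEquiv e).hodgeNorm y = Q.hodgeNorm (e.symm.toLinearMap.baseChange ℂ y) := by
  rw [Polarization.mapEquiv, hodgeNorm_copy, hodgeNorm_comapEquiv]

end Polarization

/-! ## §3 Transport along `e⁻¹`: the image flag and the form `Q(e⁻¹ x, e⁻¹ y)` -/

/-- **The Hodge filtration of `H.comapEquiv e⁻¹` is the image flag `e_ℂ F^•`** (for `H` on `V` and `e : V ≃ W`).
[cite: DeligneHodgeII1971, 1.2.5, 2.1.15] -/
theorem comapEquiv_symm_F_eq_map (H : HodgeStructure V n) (e : V ≃ₗ[ℚ] W) (p : ℤ) :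
    (H.comapEquiv e.symm).F p = (H.F p).map (e.toLinearMap.baseChange ℂ) := by
  ext y
  rw [comapEquiv_F, Submodule.mem_comap, Submodule.mem_map]
  constructor
  · intro hy
    exact ⟨_, hy, baseChange_apply_symm_baseChange e y⟩
  · rintro ⟨x, hx, rfl⟩
    rwa [symm_baseChange_apply_baseChange]

/-- `e_ℂ x ∈ F^p(H.comapEquiv e⁻¹) ⟺ x ∈ F^p(H)`. [cite: DeligneHodgeII1971, 1.2.5, 2.1.15] -/
theorem baseChange_mem_comapEquiv_symm_F_iff (H : HodgeStructure V n) (e : V ≃ₗ[ℚ] W) (p : ℤ) (x : ℂ ⊗[ℚ] V) :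
    e.toLinearMap.baseChange ℂ x ∈ (H.comapEquiv e.symm).F p ↔ x ∈ H.F p := by
  rw [comapEquiv_F, Submodule.mem_comap, symm_baseChange_apply_baseChange]

/-- The Hodge pieces of `H.comapEquiv e⁻¹` are the image pieces `e_ℂ V^{p,q}`. [cite: DeligneHodgeII1971, 1.2.5, 2.1.15] -/
theorem comapEquiv_symm_piece_eq_map (H : HodgeStructure V n) (e : V ≃ₗ[ℚ] W) (p q : ℤ) :
    (H.comapEquiv e.symm).piece p q = (H.piece p q).map (e.toLinearMap.baseChange ℂ) := by
  ext y
  rw [comapEquiv_piece, Submodule.mem_comap, Submodule.mem_map]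
  constructor
  · intro hy
    exact ⟨_, hy, baseChange_apply_symm_baseChange e y⟩
  · rintro ⟨x, hx, rfl⟩
    rwa [symm_baseChange_apply_baseChange]

/-- The form of `Q.comapEquiv e⁻¹` as an equation of bilinear forms: `(Q.comapEquiv e⁻¹)(e x, e y) = Q(x, y)`.
[cite: CarlsonMullerStachPeters2017, §2.3 eq. (2.6)] -/
theorem Polarization.comapEquiv_symm_form_apply_apply {H : HodgeStructure V n} (Q : Polarization H) (e : V ≃ₗ[ℚ] W) (x y : V) :
    (Q.comapEquiv e.symm).form (e x) (e y) = Q.form x y := by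
  rw [Polarization.comapEquiv_form_apply, LinearEquiv.symm_apply_apply, LinearEquiv.symm_apply_apply]

/-- **Uniqueness of the transported form**: if a bilinear form `Q′` on `W` satisfies `Q′(e x, e y) = Q(x, y)`, then
`(Q.comapEquiv e⁻¹).form = Q′`. [cite: CarlsonMullerStachPeters2017, §2.3 eq. (2.6)] -/
theorem Polarization.comapEquiv_symm_form_eq_of_forall {H : HodgeStructure V n} (Q : Polarization H) (e : V ≃ₗ[ℚ] W)
    {Q' : LinearMap.BilinForm ℚ W} (hQ' : ∀ x y : V, Q' (e x) (e y) = Q.form x y) : (Q.comapEquiv e.symm).form = Q' := by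
  refine LinearMap.ext fun x => LinearMap.ext fun y => ?_
  rw [Polarization.comapEquiv_form_apply, ← hQ', LinearEquiv.apply_symm_apply, LinearEquiv.apply_symm_apply]

/-! ## §4 Chart-invariance of «`v` is close to `F^p`» (CDK 2.15) -/

namespace Polarization

/-- **The approximate-membership relation of Cattani–Deligne–Kaplan 2.15 is transported along `e`**: «`v ∼_Y F` if `v + w ∈ F` with
`|w| ≤ exp(−αY)|v|`» — for the relative bound `ε`,
`(∃ f ∈ F^p(H.comapEquiv e), ‖x − f‖_{Q.comapEquiv e} ≤ ε‖x‖_{Q.comapEquiv e}) ⟺ (∃ f ∈ F^p(H), ‖e_ℂ x − f‖_Q ≤ ε‖e_ℂ x‖_Q)`.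
[cite: CattaniDeligneKaplan1995, 2.15 (p. 491) and 2.17 (ii) (p. 492)] -/
theorem exists_mem_F_hodgeNorm_sub_le_comapEquiv_iff {H : HodgeStructure W n} (Q : Polarization H) (e : V ≃ₗ[ℚ] W) (p : ℤ)
    (x : ℂ ⊗[ℚ] V) (ε : ℝ) :
    (∃ f ∈ (H.comapEquiv e).F p, (Q.comapEquiv e).hodgeNorm (x - f) ≤ ε * (Q.comapEquiv e).hodgeNorm x) ↔
      ∃ f ∈ H.F p, Q.hodgeNorm (e.toLinearMap.baseChange ℂ x - f) ≤ ε * Q.hodgeNorm (e.toLinearMap.baseChange ℂ x) := by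
  simp only [hodgeNorm_comapEquiv, map_sub, comapEquiv_F, Submodule.mem_comap]
  constructor
  · rintro ⟨f, hf, hle⟩
    exact ⟨_, hf, hle⟩
  · rintro ⟨f, hf, hle⟩
    refine ⟨e.symm.toLinearMap.baseChange ℂ f, ?_, ?_⟩
    · rwa [baseChange_apply_symm_baseChange]
    · rwa [baseChange_apply_symm_baseChange]

/-- The same with an ABSOLUTE bound `δ` on the distance: `(∃ f ∈ F^p(H.comapEquiv e), ‖x − f‖ ≤ δ) ⟺ (∃ f ∈ F^p(H), ‖e_ℂ x − f‖ ≤ δ)`.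
[cite: CattaniDeligneKaplan1995, 2.15 (p. 491)] -/
theorem exists_mem_F_hodgeNorm_sub_le_const_comapEquiv_iff {H : HodgeStructure W n} (Q : Polarization H) (e : V ≃ₗ[ℚ] W) (p : ℤ)
    (x : ℂ ⊗[ℚ] V) (δ : ℝ) :
    (∃ f ∈ (H.comapEquiv e).F p, (Q.comapEquiv e).hodgeNorm (x - f) ≤ δ) ↔
      ∃ f ∈ H.F p, Q.hodgeNorm (e.toLinearMap.baseChange ℂ x - f) ≤ δ := by
  simp only [hodgeNorm_comapEquiv, map_sub, comapEquiv_F, Submodule.mem_comap]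
  constructor
  · rintro ⟨f, hf, hle⟩
    exact ⟨_, hf, hle⟩
  · rintro ⟨f, hf, hle⟩
    refine ⟨e.symm.toLinearMap.baseChange ℂ f, ?_, ?_⟩
    · rwa [baseChange_apply_symm_baseChange]
    · rwa [baseChange_apply_symm_baseChange]

/-- **Through `e⁻¹`** (the form used for a chart `e : V_s ≃ V` of a variation, the structure on the model space `V` being
`H_s.comapEquiv e⁻¹`): `(∃ f ∈ F^p(H.comapEquiv e⁻¹), ‖e_ℂ x − f‖ ≤ ε‖e_ℂ x‖) ⟺ (∃ f ∈ F^p(H), ‖x − f‖_Q ≤ ε‖x‖_Q)`.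
[cite: CattaniDeligneKaplan1995, 2.15 (p. 491) and 2.17 (ii) (p. 492)] -/
theorem exists_mem_F_hodgeNorm_sub_le_comapEquiv_symm_iff {H : HodgeStructure V n} (Q : Polarization H) (e : V ≃ₗ[ℚ] W) (p : ℤ)
    (x : ℂ ⊗[ℚ] V) (ε : ℝ) :
    (∃ f ∈ (H.comapEquiv e.symm).F p, (Q.comapEquiv e.symm).hodgeNorm (e.toLinearMap.baseChange ℂ x - f) ≤
        ε * (Q.comapEquiv e.symm).hodgeNorm (e.toLinearMap.baseChange ℂ x)) ↔
      ∃ f ∈ H.F p, Q.hodgeNorm (x - f) ≤ ε * Q.hodgeNorm x := by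
  rw [exists_mem_F_hodgeNorm_sub_le_comapEquiv_iff, symm_baseChange_apply_baseChange]

/-- Distances to `F^p` are transported: `‖x − f‖_{Q.comapEquiv e} ≤ δ` for some `f ∈ F^p(H.comapEquiv e)` as soon as
`‖e_ℂ x − g‖_Q ≤ δ` for some `g ∈ F^p(H)` — the witness is `f = e_ℂ⁻¹ g`. [cite: CattaniDeligneKaplan1995, 2.15 (p. 491)] -/
theorem exists_mem_F_hodgeNorm_sub_le_comapEquiv_of {H : HodgeStructure W n} (Q : Polarization H) (e : V ≃ₗ[ℚ] W) {p : ℤ}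
    {x : ℂ ⊗[ℚ] V} {δ : ℝ} {g : ℂ ⊗[ℚ] W} (hg : g ∈ H.F p) (hle : Q.hodgeNorm (e.toLinearMap.baseChange ℂ x - g) ≤ δ) :
    ∃ f ∈ (H.comapEquiv e).F p, (Q.comapEquiv e).hodgeNorm (x - f) ≤ δ :=
  (Q.exists_mem_F_hodgeNorm_sub_le_const_comapEquiv_iff e p x δ).2 ⟨g, hg, hle⟩

end Polarization

end Literature.AlgebraicGeometry.Motives.HodgeStructure

end
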